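import Summits.ValiantsHypothesis.ValiantsHypothesis.Theorems.SymPencilPerFourPeeledTwoPencilCaseA

/-!
# Route `SymPencil` — inner rank of the `2 | 2` row split of `per_4`, PEELED case: EXISTENCE of the
# base vector `a₀` for the Case-A two-pencil frames (`--supports` stmt-ValiantsHypothesis-5674
# `SdcSuperquadratic`; (8,8) column, memo `NOTE-p8g15-5674-R2-two-pencil.md` §8 (T1); rung currency only)

For the A₃ recipe (`…TwoPencilCaseA`, `…TwoPencilFrameData.incidence_caseA`) one needs `a₀ ∈ K⁴`
with non-zero coordinates such that `h_k := a₀_k (Ψᵀ a₀)_k` (`k = 0, 1, 2`) are non-zero and pairwise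
distinct.  **Theorem** (`exists_caseA_base`): such an `a₀` exists over any field of characteristic
zero as soon as the columns `0, 1, 2` of `Ψ` are non-zero and no two of them form a «swap pair»
(`col_i = λ e_j ∧ col_j = λ e_i`), the hypothesis being given by explicit witnesses.  Proof: the
product of the polynomials `X_k`, `H_k = X_k · Σ_m Ψ_{mk} X_m` and `H_i - H_j` is a non-zero
multivariate polynomial (each factor has a non-zero coefficient), hence does not vanish identically on
the infinite field `K` (`MvPolynomial.funext`).

Honest framing: infrastructure for the `(8,8,11)` case analysis; no cell closes here; the window
of record, the crux `SdcSuperquadratic` and `VP ≠ VNP` are untouched.  No definitions, no named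
facts. [folklore]
-/

noncomputable section

-- single-conjunct layout: Sub = Summit, duplicated namespace component intended
set_option linter.dupNamespace false

namespace Summit.ValiantsHypothesis.ValiantsHypothesis.Theorems.SymPencilPerFourPeeledTwoPencilCaseAExists

open Matrix Finset MvPolynomial

universe u

variable {K : Type u} [Field K]

/-- The coefficient of `X_m` in the linear form `Σ_i Ψ_{ik} X_i` is `Ψ_{mk}`. [folklore] -/
theorem coeff_linform (Ψ : Matrix (Fin 4) (Fin 4) K) (k m : Fin 4) :
    coeff (Finsupp.single m 1) (∑ i : Fin 4, C (Ψ i k) * X i : MvPolynomial (Fin 4) K) = Ψ m k := by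
  classical
  rw [coeff_sum]
  simp only [coeff_C_mul, coeff_X]
  rw [Finset.sum_eq_single m]
  · simp
  · intro i _ hi
    rw [if_neg, mul_zero]
    intro h
    exact hi (Finsupp.single_left_injective one_ne_zero h)
  · intro h; exact absurd (Finset.mem_univ m) h

/-- Evaluation of the linear form: `eval a (Σ_i Ψ_{ik} X_i) = (Ψᵀ a)_k`. [folklore] -/
theorem eval_linform (Ψ : Matrix (Fin 4) (Fin 4) K) (k : Fin 4) (a : Fin 4 → K) :
    eval a (∑ i : Fin 4, C (Ψ i k) * X i : MvPolynomial (Fin 4) K) = (Ψᵀ *ᵥ a) k := by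
  simp [map_sum, Matrix.mulVec, dotProduct, Matrix.transpose_apply]

/-- **Existence of the Case-A base vector.**  See the module docstring. [folklore] -/
theorem exists_caseA_base [CharZero K] (Ψ : Matrix (Fin 4) (Fin 4) K)
    (hc : ∀ k : Fin 4, k ≠ 3 → ∃ m, Ψ m k ≠ 0)
    (hns : ∀ i j : Fin 4, i ≠ 3 → j ≠ 3 → i ≠ j →
      (∃ m, m ≠ j ∧ m ≠ i ∧ Ψ m i ≠ 0) ∨ (∃ m, m ≠ i ∧ m ≠ j ∧ Ψ m j ≠ 0) ∨
        Ψ i i ≠ 0 ∨ Ψ j j ≠ 0 ∨ Ψ j i ≠ Ψ i j) :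
    ∃ a₀ : Fin 4 → K, (∀ k, a₀ k ≠ 0) ∧
      (∀ k : Fin 4, k ≠ 3 → a₀ k * (Ψᵀ *ᵥ a₀) k ≠ 0) ∧
      (∀ i j : Fin 4, i ≠ 3 → j ≠ 3 → i ≠ j →
        a₀ i * (Ψᵀ *ᵥ a₀) i ≠ a₀ j * (Ψᵀ *ᵥ a₀) j) := by
  classical
  haveI : Infinite K := Infinite.of_injective ((↑) : ℕ → K) Nat.cast_injective
  -- the polynomials
  let L : Fin 4 → MvPolynomial (Fin 4) K := fun k => ∑ i : Fin 4, C (Ψ i k) * X i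
  let H : Fin 4 → MvPolynomial (Fin 4) K := fun k => X k * L k
  have hL : ∀ k : Fin 4, k ≠ 3 → L k ≠ 0 := by
    intro k hk hzero
    obtain ⟨m, hm⟩ := hc k hk
    apply hm
    have := coeff_linform Ψ k m
    rw [show (∑ i : Fin 4, C (Ψ i k) * X i : MvPolynomial (Fin 4) K) = L k from rfl, hzero,
      coeff_zero] at this
    exact this.symm
  have hH : ∀ k : Fin 4, k ≠ 3 → H k ≠ 0 := fun k hk => mul_ne_zero (X_ne_zero k) (hL k hk)
  -- coefficients of `H_i` at quadratic monomials
  have cH : ∀ (i m n : Fin 4), coeff (Finsupp.single n 1 + Finsupp.single m 1) (H i) =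
      if i = n then Ψ m i else if i = m then Ψ n i else 0 := by
    intro i m n
    show coeff (Finsupp.single n 1 + Finsupp.single m 1) (X i * L i) = _
    by_cases hin : i = n
    · subst hin
      rw [coeff_X_mul, if_pos rfl]; exact coeff_linform Ψ i m
    · rw [if_neg hin]
      by_cases him : i = m
      · subst him
        rw [if_pos rfl, add_comm, coeff_X_mul]; exact coeff_linform Ψ i n
      · rw [if_neg him, coeff_X_mul']
        rw [if_neg]
        intro hmem
        rw [Finsupp.mem_support_iff, Finsupp.add_apply, Finsupp.single_apply, Finsupp.single_apply,
          if_neg (Ne.symm hin), if_neg (Ne.symm him), add_zero] at hmem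
        exact hmem rfl
  have hHH : ∀ i j : Fin 4, i ≠ 3 → j ≠ 3 → i ≠ j → H i - H j ≠ 0 := by
    intro i j hi hj hij hzero
    have hc0 : ∀ d, coeff d (H i) = coeff d (H j) := fun d => by
      have := congr_arg (coeff d) hzero
      rwa [coeff_sub, coeff_zero, sub_eq_zero] at this
    rcases hns i j hi hj hij with ⟨m, hmj, hmi, hm⟩ | ⟨m, hmi, hmj, hm⟩ | hii | hjj | hsym
    · have h := hc0 (Finsupp.single i 1 + Finsupp.single m 1)
      rw [cH, cH, if_pos rfl, if_neg (Ne.symm hij), if_neg (Ne.symm hmj)] at h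
      exact hm h
    · have h := hc0 (Finsupp.single j 1 + Finsupp.single m 1)
      rw [cH, cH, if_neg hij, if_neg (Ne.symm hmi), if_pos rfl] at h
      exact hm h.symm
    · have h := hc0 (Finsupp.single i 1 + Finsupp.single i 1)
      rw [cH, cH, if_pos rfl, if_neg (Ne.symm hij), if_neg (Ne.symm hij)] at h
      exact hii h
    · have h := hc0 (Finsupp.single j 1 + Finsupp.single j 1)
      rw [cH, cH, if_neg hij, if_neg hij, if_pos rfl] at h
      exact hjj h.symm
    · have h := hc0 (Finsupp.single i 1 + Finsupp.single j 1)
      rw [cH, cH, if_pos rfl, if_neg (Ne.symm hij), if_pos rfl] at h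
      exact hsym h
  -- the product polynomial
  let F : MvPolynomial (Fin 4) K :=
    X 0 * X 1 * X 2 * X 3 * (H 0 * H 1 * H 2) * ((H 0 - H 1) * (H 0 - H 2) * (H 1 - H 2))
  have hF : F ≠ 0 := by
    have d3 : (3 : Fin 4) ≠ 3 → False := fun h => h rfl
    refine mul_ne_zero (mul_ne_zero ?_ ?_) ?_
    · exact mul_ne_zero (mul_ne_zero (mul_ne_zero (X_ne_zero 0) (X_ne_zero 1)) (X_ne_zero 2))
        (X_ne_zero 3)
    · exact mul_ne_zero (mul_ne_zero (hH 0 (by decide)) (hH 1 (by decide))) (hH 2 (by decide))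
    · exact mul_ne_zero (mul_ne_zero (hHH 0 1 (by decide) (by decide) (by decide))
        (hHH 0 2 (by decide) (by decide) (by decide))) (hHH 1 2 (by decide) (by decide) (by decide))
  -- a non-root
  obtain ⟨a, ha⟩ : ∃ a : Fin 4 → K, eval a F ≠ 0 := by
    by_contra h
    push Not at h
    exact hF (MvPolynomial.funext fun a => by rw [h a, map_zero])
  -- read off the factors
  have evH : ∀ k, eval a (H k) = a k * (Ψᵀ *ᵥ a) k := fun k => by
    show eval a (X k * L k) = _
    rw [map_mul, eval_X]; exact congr_arg _ (eval_linform Ψ k a)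
  simp only [F, map_mul, map_sub, eval_X, evH] at ha
  refine ⟨a, ?_, ?_, ?_⟩
  · intro k
    fin_cases k
    · exact fun h => ha (by simp only [Fin.zero_eta] at h; simp [h])
    · exact fun h => ha (by simp only [Fin.mk_one] at h; simp [h])
    · exact fun h => ha (by simp only [Fin.reduceFinMk] at h; simp [h])
    · exact fun h => ha (by simp only [Fin.reduceFinMk] at h; simp [h])
  · intro k hk
    fin_cases k
    · exact fun h => ha (by simp only [Fin.zero_eta] at h; simp [h])
    · exact fun h => ha (by simp only [Fin.mk_one] at h; simp [h])
    · exact fun h => ha (by simp only [Fin.reduceFinMk] at h; simp [h])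
    · exact absurd rfl hk
  · intro i j hi hj hij
    fin_cases i <;> fin_cases j
    all_goals first
      | exact absurd rfl hij
      | exact absurd rfl hi
      | exact absurd rfl hj
      | exact fun h => ha (by simp only [Fin.zero_eta, Fin.mk_one, Fin.reduceFinMk] at h
                              simp [h, sub_self])

end Summit.ValiantsHypothesis.ValiantsHypothesis.Theorems.SymPencilPerFourPeeledTwoPencilCaseAExists

end
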